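import Summits.AtomisticToContinuum.FouriersLaw.Theses.VanishingNoiseTransfer
import Summits.AtomisticToContinuum.FouriersLaw.Theorems.VanishingNoiseTransferNoisyFourierFlipNessExists
import Summits.AtomisticToContinuum.FouriersLaw.Theorems.VanishingNoiseTransferNoisyFourierFlipSteadyStateHasSmoothDensity
import Summits.AtomisticToContinuum.FouriersLaw.Theorems.VanishingNoiseTransferNoisyFourierFlipSteadyStateEqBindResolventKernel
import Summits.AtomisticToContinuum.FouriersLaw.Theorems.VanishingNoiseTransferNoisyFourierFlipFiniteResponse
import Summits.AtomisticToContinuum.FouriersLaw.Theorems.VanishingNoiseTransferNoisyFourierFlipPositiveConductance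
import Summits.AtomisticToContinuum.FouriersLaw.Theorems.VanishingNoiseTransferNoisyFourierFlipConductanceCeiling
import Literature.MathematicalPhysics.KineticTheory.VelocityFlipNoise
import Literature.MathematicalPhysics.KineticTheory.VelocityFlipEmbeddedChain
import Summits.AtomisticToContinuum.FouriersLaw.Theorems.NoisyFourier.Negative.GluingShellTightness

/-!
# Line `sector-dirichlet-gluing` — skeleton for crux `VanishingNoiseTransfer.NoisyFourier`
(item stmt-AtomisticToContinuum-11977; crux-plan of idea card
`Cruxes/NoisyFourier/Ideas/sector-dirichlet-gluing.md`, triage r1-1/2/3: pass)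

The crux is `FlipFouriersLawFor (pinnedChain ω₂ lam β γ) ε` for all parameters `> 0` and every
flip rate `ε > 0` (Disproof §0 `noisyFourier_iff`; here re-proved as the last step of
`NoisyFourier_of` by `subst`/defeq, `isFlipSteadyState_fun_eq`). Notation: `P = pinnedChain …`,
`D_N(ε)` the finite-length response coefficient of clause (ii), `G_N := D_N/(N-1)` the conductance,
`R_N := (N-1)/D_N(ε)` the bath-to-bath resistance.

THE LINE (card, sharpened by the triage panel; reshaped by the leads, 2026-08-16). Clause (i) and the
fixed-`N` objects are print-level flip theory: existence of the weak flip steady state (embedded chain at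
the flip times + discrete Krylov–Bogoliubov), uniqueness (smooth density by the coupled Hörmander system +
resolvent identification `μ = (μQ)R_{Nε}` + Doeblin for the embedded flip kernel), existence of the
response `D_N(ε)` and its positivity (mild forward fields of `L_{T_L,T_R} + εS`, Kubo link,
fluctuation–dissipation) — ALL LANDED (stubs 1a, 1b-α, 1b-β, 2, 3). The `N → ∞` content is carried by
two statements about the response sequence along the (unique) flip-steady family: a RESPONSE CEILING
`D_N ≤ K` (Stub 4′: entropy production at linear response — the flip dissipation of the density corrector
is `O(D_N/(N−1))` while every bond carries the full response and each bond current is odd under one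
velocity flip; Bernardin–Olla 2011 §3) and quasi-subadditivity of the bath-to-bath resistances
`R_{N+M} ≤ R_N + R_M + C'` (Stub 5, the Thomson/odd-flux side of the card; the one statement of the line
without a printed proof). Fekete on `{N ≥ 2}` for `R_N`, with the ceiling as the linear lower bound
`R_N ≥ (N−1)/K` and positivity, gives `D_N → 1/ℓ > 0` (`Drefute.tendsto_pos_of_resistanceGluing_of_bdd`,
landed by the crux's refuter together with the tightness examples showing that the card's original
σ-gluing `σ_{N+M} ≤ σ_N + σ_M + C` was neither sufficient with positivity alone nor necessary — it is
retired). Uniqueness transfers clause (ii) from the canonical family to every flip-steady family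
(Disproof §5 `flipFouriersLawFor_iff_exists_family`).

Registered stubs after the cycle-c1/c3 reshapes: `stub_flipNessExists` (LANDED p85824),
`stub_flipSteadyState_hasSmoothDensity` (LANDED p118995), `stub_flipSteadyState_eq_bind_resolventKernel`
(1b-β, LANDED p121372), `stub_flipFiniteResponse` (LANDED p120199), `stub_flipPositiveConductance` (LANDED p120329),
`stub_flipConductanceCeiling` (4′, LANDED p123309), and — the ONLY open stub after the cycle-c3 reshape —
`stub_flipKuboLimit` (5″): the finite-volume Green–Kubo conductivity `(L−1)·G_L(ε,T)` of the flip chain, read off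
ANY family of classical forward fields of the equilibrium generator `L_{T,T} + εS`, converges to a positive limit.
This is EXACTLY the remaining content of clause (ii) (no strengthening): forward fields exist
(`FlipPositiveConductance.dualForwardFields_of_mild_hypo_upgrade_cont` + the four landed `VanishingNoiseBound` stubs),
are unique up to constants (`VanishingNoiseBound.flip_forwardField_unique`), and `D_L = (L−1)·G_L` along the unique
flip-steady family (`VanishingNoiseBound.flip_kuboLink_of_dualForwardFields`); the reduction
`LineAssembly.noisyFourier_of_kuboLimit` is LANDED (cycle c3). The former Stub 5 `stub_resistanceGluing` (series law
`R_{N+M} ≤ R_N + R_M + C`, the card's Thomson mechanism) is RETIRED as a registered stub but stays a SUFFICIENT route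
with its importable reduction `LineAssembly.noisyFourier_of_resistanceGluing` (p124321); two further sufficient routes
are landed in `Theorems/VanishingNoiseTransferNoisyFourierOfResponseLimit.lean` (p127289): the dual series law
`R_N + R_M ≤ R_{N+M} + C` plus an `N`-uniform floor (`noisyFourier_of_superadditiveResistance_of_floor`), and eventual
monotonicity `D_N ≤ D_{N+1}` (`noisyFourier_of_monotoneResponse`). Skeleton theorem:
`NoisyFourier_of : VanishingNoiseTransfer.NoisyFourier := noisyFourier_iff_flipFouriersLawFor.2
(flipFouriersLawFor_of_kuboLimit stub_flipKuboLimit)` (no hypotheses; concludes the crux BY NAME; `sorry` enters only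
through `stub_flipKuboLimit`; the reduction is the in-file copy of the landed `LineAssembly.noisyFourier_of_kuboLimit`). The series-law
composition `flipFouriersLawFor_of_gluing` is kept below, sorry-free, as documentation of the card's route.
-/

noncomputable section

namespace Summit.AtomisticToContinuum.FouriersLaw.Cruxes.NoisyFourier.SectorDirichletGluing

open Filter Topology MeasureTheory
open Literature.MathematicalPhysics.KineticTheory.HeatConduction
open Summit.AtomisticToContinuum.FouriersLaw.Theorems
open Summit.AtomisticToContinuum.FouriersLaw.Theorems.SuperadditiveResistance.DeviceLiouville (kin)
open Summit.AtomisticToContinuum.FouriersLaw.Cruxes.ConductanceLowerBound.ForecastSensitivity (memLp_two_of_abs_le_exp)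

/-! ## Registered stubs (the lemmas of the line; `sorry` only here) -/

/-! **Stub 1a — clause (i), existence half: LANDED** (wave 2, p85824):
`stub_flipNessExists` is now the theorem of
`Summits/AtomisticToContinuum/FouriersLaw/Theorems/VanishingNoiseTransferNoisyFourierFlipNessExists.lean`
(imported above; same fully-qualified name, same registered signature), proved from the Literature
theorems `pinnedChain_exists_isFlipSteadyState` (VelocityFlipSteadyStateExists.lean, p84388:
embedded chain at the flip times `K = Q ∘ₖ R_{Nε}`), `pinnedChain_exists_resolventKernel`
(LangevinChainResolvent.lean, p80888: resolvent kernel of the flip-free transition semigroup —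
Markov, Dynkin/resolvent identity on `C_c^∞`, Feller, contracting `e^{θH}` bound from CEHR Thm 5.1)
and `MarkovChain.exists_invariant_of_lyapunov` (KrylovBogoliubovDiscrete.lean, p78481: discrete-time
Krylov–Bogoliubov / Foster–Lyapunov); `N = 0` Dirac, `N = 1` Gibbs at the mean temperature. -/

/-! **Stub 1b — clause (i), uniqueness half** (`flipNessUnique`, PROVED below from the two registered
stubs 1b-α / 1b-β of the cycle-c1 reshape and the landed Doeblin half U2). The `ε = 0` twin
`NessUnique` (stmt-0741) was PROVED on 2026-08-16 (`Theorems/EmbeddedDrudeMourreNessUnique*.lean`: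
Hörmander smooth density, integration by parts to the pointwise reversed Fokker–Planck equation,
Lebesgue duality with the reversed Langevin kernels, truncation + Duhamel); the flip version follows the
same architecture with two changes: the smooth density needs the COUPLED hypoellipticity theorem
(`Literature/Analysis/Hypoelliptic/CoupledSystem.lean`, the `2^N` flip-conjugates of `L*`), and the
identification is with the RESOLVENT of the flip-free semigroup (`μ = (μQ) R_{Nε}`, embedded chain at
the flip times) instead of invariance, so that U2 (`pinnedChain_embeddedFlipKernel_invariant_unique`,
VelocityFlipEmbeddedChain.lean p88937) finishes. Uses `γ > 0` (Disproof §3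
`noisyFourier_false_without_bathCoupling`: at `γ = 0`, `N = 1` has two flip steady states). -/

/-! **Stub 1b-α — a weak flip steady state has a smooth density: LANDED** (cycle c1, p118995;
helper p117939): `stub_flipSteadyState_hasSmoothDensity` is now the theorem of
`Summits/AtomisticToContinuum/FouriersLaw/Theorems/VanishingNoiseTransferNoisyFourierFlipSteadyStateHasSmoothDensity.lean`
(imported above; same fully-qualified name, same registered signature): the `2^N` flip-conjugates
`(Θ_S)_* μ` solve a square distributional system with diagonal bracket-generating Hörmander principal
parts (conjugates of `L* - Nε`, CEHR Prop. 4.1) and constant coupling, smooth by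
`Literature.Analysis.Hypoelliptic.isSmoothOn_of_coupledSystem` (Hörmander 1967 Thm 1.1 in the tree). -/

/-! **Stub 1b-β — the resolvent identification of a weak flip steady state: LANDED** (cycle c1;
helpers p117865 p117870 p118498 p118905 p117930 p120200 p120269):
`stub_flipSteadyState_eq_bind_resolventKernel` is now the theorem of
`Summits/AtomisticToContinuum/FouriersLaw/Theorems/VanishingNoiseTransferNoisyFourierFlipSteadyStateEqBindResolventKernel.lean`
(imported above; same fully-qualified name, same registered signature): with `r = Nε`, `g = ε∑ᵢ ρ∘Θᵢ`
and `c = 2γ - r`, integration by parts gives the pointwise equation `L̂ρ + cρ + g = 0`; `C²_c`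
truncations with `L¹`-small defects (weighted Fisher information with a source), Duhamel for the
reversed Langevin kernels with rate `c`, Fatou, Lebesgue duality `dx P_t(x,dy) = e^{2γt} dy P̂_t(y,dx)`
and `t → ∞` give `(μQ)R_r ≤ μ` setwise, hence equality of the two probability measures. -/

/-- **Clause (i), uniqueness half — two weak flip steady states coincide** (all `N`, `T_L, T_R > 0`,
every `ε > 0`; the statement of the former registered stub `stub_flipNessUnique`, now PROVED from Stubs
1b-α, 1b-β and U2). For `N ≥ 1`: both `μ` and `ν` equal `(·Q) R_{Nε}` of themselves, so `μQ` and `νQ`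
are invariant probability measures of the embedded flip kernel `Q ∘ₖ R_{Nε}` and coincide
(`pinnedChain_embeddedFlipKernel_invariant_unique`), whence `μ = (μQ)R = (νQ)R = ν`; for `N = 0`
phase space is a point. [cite: BernardinOlla2011, Prop 1] -/
theorem flipNessUnique :
    ∀ ω₂ lam β γ : ℝ, 0 < ω₂ → 0 < lam → 0 < β → 0 < γ → ∀ ε : ℝ, 0 < ε →
      ∀ (N : ℕ) (T_L T_R : ℝ), 0 < T_L → 0 < T_R →
        ∀ μ ν : MeasureTheory.Measure
            (Literature.MathematicalPhysics.KineticTheory.HeatConduction.PhaseSpace N),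
          (Literature.MathematicalPhysics.KineticTheory.HeatConduction.pinnedChain
              ω₂ lam β γ).IsFlipSteadyState N T_L T_R ε μ →
          (Literature.MathematicalPhysics.KineticTheory.HeatConduction.pinnedChain
              ω₂ lam β γ).IsFlipSteadyState N T_L T_R ε ν → μ = ν := by
  intro ω₂ lam β γ hω hl hβ hγ ε hε N T_L T_R hL hR μ ν hμ hν
  haveI := hμ.1
  haveI := hν.1
  rcases Nat.eq_zero_or_pos N with rfl | hN
  · -- `N = 0`: phase space is a point
    refine Measure.ext fun A _ => ?_
    rcases A.eq_empty_or_nonempty with rfl | hne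
    · simp
    · rw [Subsingleton.eq_univ_of_nonempty hne, measure_univ, measure_univ]
  · set S := pinnedChainSemigroup hω hl.le hβ.le hγ.le hN hL.le hR.le with hS
    have hr : 0 < (N : ℝ) * ε := by positivity
    haveI := S.isMarkovKernel_resolventKernel hr
    haveI := S.isMarkovKernel_embeddedFlipKernel hr
    have hμ' := stub_flipSteadyState_eq_bind_resolventKernel ω₂ lam β γ hω hl hβ hγ ε hε N T_L T_R hN
      hL hR μ hμ (stub_flipSteadyState_hasSmoothDensity ω₂ lam β γ hω hl hβ hγ ε hε N T_L T_R hN hL hR μ hμ)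
    have hν' := stub_flipSteadyState_eq_bind_resolventKernel ω₂ lam β γ hω hl hβ hγ ε hε N T_L T_R hN
      hL hR ν hν (stub_flipSteadyState_hasSmoothDensity ω₂ lam β γ hω hl hβ hγ ε hε N T_L T_R hN hL hR ν hν)
    -- `ρ Q` is invariant for the embedded flip kernel whenever `ρ = (ρ Q) R`
    have hinv : ∀ ρ : Measure (PhaseSpace N),
        ρ = (ρ.bind (flipKernel N)).bind (S.resolventKernel ((N : ℝ) * ε)) →
        ProbabilityTheory.Kernel.Invariant (S.embeddedFlipKernel ((N : ℝ) * ε))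
          (ρ.bind (flipKernel N)) := by
      intro ρ h
      show (ρ.bind (flipKernel N)).bind (S.embeddedFlipKernel ((N : ℝ) * ε)) = ρ.bind (flipKernel N)
      rw [S.embeddedFlipKernel_eq, ← Measure.comp_assoc]
      show ((ρ.bind (flipKernel N)).bind (S.resolventKernel ((N : ℝ) * ε))).bind (flipKernel N) =
        ρ.bind (flipKernel N)
      rw [← h]
    haveI : IsProbabilityMeasure (μ.bind (flipKernel N)) := by infer_instance
    haveI : IsProbabilityMeasure (ν.bind (flipKernel N)) := by infer_instance
    have hQ : μ.bind (flipKernel N) = ν.bind (flipKernel N) :=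
      pinnedChain_embeddedFlipKernel_invariant_unique hω hl.le hβ hγ hN hL hR hr (hinv μ hμ') (hinv ν hν')
    rw [hμ', hν', hQ]

/-! **Stub 2 — fixed-`N` linear response of the flip chain exists: LANDED** (cycle c1, worker W-2,
p120199; helpers p117687 p118661 p118531): `stub_flipFiniteResponse` is now the theorem of
`Summits/AtomisticToContinuum/FouriersLaw/Theorems/VanishingNoiseTransferNoisyFourierFlipFiniteResponse.lean`
(imported above; same fully-qualified name, same registered signature): ROAD B — mild forward fields of
`L_{T_L,T_R} + εS` (`flip_mildDistributional`), their hypoelliptic/continuity upgrades landed for the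
sister crux `VanishingNoiseBound` (`stub_flipHypoelliptic`, `stub_flipSmoothMildUpgrade`,
`stub_flipMildContinuity`), and the dual Kubo road `flipFiniteResponse_of_dualKuboRoad`, which even
identifies the value `D_N = (N−1)γ(1/2 − (γ/2T²)(A₀−B₀))`. -/

/-! **Stub 3 — fixed-`N` flip conductances are positive: LANDED** (cycle c1, worker W-3, p120329;
helpers p117928 p118768 p118409): `stub_flipPositiveConductance` is now the theorem of
`Summits/AtomisticToContinuum/FouriersLaw/Theorems/VanishingNoiseTransferNoisyFourierFlipPositiveConductance.lean`
(imported above; same fully-qualified name, same registered signature): ROAD B —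
`flipPositiveConductance_of_dualForwardFields (dualForwardFields_of_mild_hypo_upgrade_cont MILD HYPO
UPGRADE CONT)` with the four landed `VanishingNoiseBound` stubs (`stub_flipMildDistributional`,
`stub_flipHypoelliptic`, `stub_flipSmoothMildUpgrade`, `stub_flipMildContinuity`). -/

/-! **Former Stub 4 — σ-GLUING (`∃ C, ∀ N M ≥ 2, σ_{N+M} ≤ σ_N + σ_M + C`, `σ_N := (N−1)·D_N`):
RETIRED by the cycle-c1 reshape.** It was the one stub with no printed proof (inf-variational gluing of
even correctors across an anharmonic junction; wave-1 diagnosis `stub_sigmaGluing.md`), and the crux's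
refuter showed it is neither sufficient with Stub 3 alone (`Drefute.exists_sigmaGluing_pos_tendsto_zero`)
nor necessary for clause (ii) (`Drefute.exists_tendsto_pos_not_sigmaGluing`), while Stub 5 + Stub 3 + a
response CEILING already decide clause (ii) (`Drefute.tendsto_pos_of_resistanceGluing_of_bdd`, landed in
`Theorems/NoisyFourier/Negative/GluingShellTightness.lean`, imported above). The ceiling below replaces it. -/

/-! **Stub 4′ — RESPONSE CEILING `∃ K, ∀ N ≥ 2, D_N(ε) ≤ K`: LANDED** (cycle c1, p123309; helpers p122440 p122115
p121930 p122302): `stub_flipConductanceCeiling` is now the theorem of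
`Summits/AtomisticToContinuum/FouriersLaw/Theorems/VanishingNoiseTransferNoisyFourierFlipConductanceCeiling.lean`
(imported above; same fully-qualified name, same registered signature): entropy production at linear response —
bond-wise response identity, one-flip oddness of the bond currents, fluctuation–dissipation for `h = g_0 − g_{N−1}`,
Cauchy–Schwarz over the bonds, `D_N ≤ 16 m N/((N−1) ε T²)` with the Gibbs moment `m` bounded uniformly in `N`.
It replaced the retired σ-gluing stub (see above). -/

/-! **Former Stub 5 — R-GLUING `∃ C', ∀ N M ≥ 2, R_{N+M} ≤ R_N + R_M + C'` (`R_N := (N−1)/D_N(ε)`, under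
uniqueness, along every flip-steady family, given positivity): RETIRED as a registered stub by the cycle-c3
reshape, KEPT as a sufficient route.** It is the card's Thomson mechanism (normalised odd flux fields glued through
a junction patch whose even divergence cancels the deleted baths' end divergences exactly) and strictly STRONGER
than clause (ii) (it forbids any approach of `D_N` to `κ_ε` from above slower than `1/N`); its reduction
`LineAssembly.noisyFourier_of_resistanceGluing` (p124321) stays importable, so a proof of the series law still
closes the crux by one `exact`. Diagnosis of three leads (item evidence stub_sigmaGluing.md, stub_resistanceGluing.md,
HALF_CONSERVED.md, CRUX_NOTES-c1/c2/c3): the junction patch needs `N`-uniform boundary-localisation of the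
anharmonic correctors / quasi-local half-conserved flux fields — not in print, no polynomial witness exists. -/

/-- **Stub 5″ — THE FINITE-VOLUME GREEN–KUBO LIMIT of the flip chain (the ONLY open stub; cycle-c3 reshape).**
For all `ω₂, lam, β, γ, T, ε > 0` there is `κ > 0` such that for EVERY family `g L` (`L ≥ 2`) of classical
forward fields of the left bath — `g L ∈ C² ∩ L²(μ_T)`, `(L_{T,T} + εS)(g L) = −(p_0² − T)` pointwise, where
`kin L 0 x = p_0²` — the Kubo sequence `(L − 1)·γ(1 − (γ/T²) ∫ g L · (p_0² − T) dμ_T)` tends to `κ`. Such families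
exist and each member is unique up to an additive constant (which the centred pairing does not see), and the
`L`-th term IS the response coefficient `D_L(ε,T)` of clause (ii) along the unique flip-steady family (landed Kubo
link), so this stub is clause (ii) itself with the fixed-`L` theory stripped — the boundary-driven Fourier law for
the anharmonic velocity-flip chain, in print only for the harmonic bulk (Bernardin–Olla 2011 Thm 3; "we are not
able to prove the same for J_s", p. 3). Known toward it (landed): `0 < (L−1)G_L ≤ K(ε,T)` for `L ≥ 2`
(`stub_flipPositiveConductance`, `stub_flipConductanceCeiling`: entropy balance ⇒ flip dissipation `≤ G_L/T²`,
one-flip oddness of the half currents). Sufficient routes with landed reductions: series law (p124321), dual series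
law + `N`-uniform floor, eventual monotonicity (p127289). Size: the crux core (XL, open in print). -/
theorem stub_flipKuboLimit :
    ∀ (ω₂ lam β γ T ε : ℝ), 0 < ω₂ → 0 < lam → 0 < β → 0 < γ → 0 < T → 0 < ε → ∃ κ : ℝ, 0 < κ ∧ ∀ g : (L : ℕ) → Literature.MathematicalPhysics.KineticTheory.HeatConduction.PhaseSpace L → ℝ, (∀ L : ℕ, 2 ≤ L → ContDiff ℝ 2 (g L) ∧ MeasureTheory.MemLp (g L) 2 ((Literature.MathematicalPhysics.KineticTheory.HeatConduction.pinnedChain ω₂ lam β γ).gibbsMeasure L T) ∧ ∀ x, (Literature.MathematicalPhysics.KineticTheory.HeatConduction.pinnedChain ω₂ lam β γ).flipGenerator L T T ε (g L) x = -(Summit.AtomisticToContinuum.FouriersLaw.Theorems.SuperadditiveResistance.DeviceLiouville.kin L 0 x - T)) → Filter.Tendsto (fun L : ℕ => ((L : ℝ) - 1) * (γ * (1 - γ / T ^ 2 * MeasureTheory.integral ((Literature.MathematicalPhysics.KineticTheory.HeatConduction.pinnedChain ω₂ lam β γ).gibbsMeasure L T) (fun x => g L x * (Summit.AtomisticToContinuum.FouriersLaw.Theorems.SuperadditiveResistance.DeviceLiouville.kin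 L 0 x - T))))) Filter.atTop (nhds κ) := by
  sorry

/-! ## Assembly: from the canonical family to `FlipFouriersLawFor` (proved) -/

/-- Clause (i) in its `∃ μ, … ∧ ∀ ν, … → ν = μ` form, from the two halves Stub 1a (existence)
and Stub 1b (uniqueness). [folklore] -/
theorem existsUnique_of_exists_of_unique
    (hE : ∀ ω₂ lam β γ : ℝ, 0 < ω₂ → 0 < lam → 0 < β → 0 < γ → ∀ ε : ℝ, 0 < ε →
      ∀ (N : ℕ) (T_L T_R : ℝ), 0 < T_L → 0 < T_R →
        ∃ μ : MeasureTheory.Measure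
            (Literature.MathematicalPhysics.KineticTheory.HeatConduction.PhaseSpace N),
          (Literature.MathematicalPhysics.KineticTheory.HeatConduction.pinnedChain
              ω₂ lam β γ).IsFlipSteadyState N T_L T_R ε μ)
    (hU : ∀ ω₂ lam β γ : ℝ, 0 < ω₂ → 0 < lam → 0 < β → 0 < γ → ∀ ε : ℝ, 0 < ε →
      ∀ (N : ℕ) (T_L T_R : ℝ), 0 < T_L → 0 < T_R →
        ∀ μ ν : MeasureTheory.Measure
            (Literature.MathematicalPhysics.KineticTheory.HeatConduction.PhaseSpace N),
          (Literature.MathematicalPhysics.KineticTheory.HeatConduction.pinnedChain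
              ω₂ lam β γ).IsFlipSteadyState N T_L T_R ε μ →
          (Literature.MathematicalPhysics.KineticTheory.HeatConduction.pinnedChain
              ω₂ lam β γ).IsFlipSteadyState N T_L T_R ε ν → μ = ν) :
    ∀ ω₂ lam β γ : ℝ, 0 < ω₂ → 0 < lam → 0 < β → 0 < γ → ∀ ε : ℝ, 0 < ε →
      ∀ (N : ℕ) (T_L T_R : ℝ), 0 < T_L → 0 < T_R →
        ∃ μ : MeasureTheory.Measure
            (Literature.MathematicalPhysics.KineticTheory.HeatConduction.PhaseSpace N),
          (Literature.MathematicalPhysics.KineticTheory.HeatConduction.pinnedChain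
              ω₂ lam β γ).IsFlipSteadyState N T_L T_R ε μ ∧
          ∀ ν : MeasureTheory.Measure
              (Literature.MathematicalPhysics.KineticTheory.HeatConduction.PhaseSpace N),
            (Literature.MathematicalPhysics.KineticTheory.HeatConduction.pinnedChain
                ω₂ lam β γ).IsFlipSteadyState N T_L T_R ε ν → ν = μ := by
  intro ω₂ lam β γ hω hl hβ hγ ε hε N T_L T_R hL hR
  obtain ⟨μ, hμ⟩ := hE ω₂ lam β γ hω hl hβ hγ ε hε N T_L T_R hL hR
  exact ⟨μ, hμ, fun ν hν => hU ω₂ lam β γ hω hl hβ hγ ε hε N T_L T_R hL hR ν μ hν hμ⟩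

/-- Uniqueness of flip steady states in the `∀ μ ν` form, from the `∃!` form of Stub 1. -/
theorem uniq_of_existsUnique {P : OscillatorChain} {ε : ℝ}
    (hEU : ∀ (N : ℕ) (T_L T_R : ℝ), 0 < T_L → 0 < T_R →
      ∃ μ : Measure (PhaseSpace N), P.IsFlipSteadyState N T_L T_R ε μ ∧
        ∀ ν : Measure (PhaseSpace N), P.IsFlipSteadyState N T_L T_R ε ν → ν = μ) :
    ∀ (N : ℕ) (T_L T_R : ℝ), 0 < T_L → 0 < T_R → ∀ μ ν : Measure (PhaseSpace N),
      P.IsFlipSteadyState N T_L T_R ε μ → P.IsFlipSteadyState N T_L T_R ε ν → μ = ν := by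
  intro N T_L T_R hL hR μ ν hμ hν
  obtain ⟨μ₀, -, hμ₀⟩ := hEU N T_L T_R hL hR
  rw [hμ₀ μ hμ, hμ₀ ν hν]

/-- **Assembly lemma.** Clause (i) plus, for every flip-steady family and every `T > 0`, response
coefficients converging to a positive limit, give `FlipFouriersLawFor`: `κ_ε(T)` is read off the
canonical family (choice), and uniqueness makes the response quotients of any flip-steady family
agree with the canonical ones for `|δ| < 2T` (`Filter.Tendsto.congr'`), as in
`FeketeSeriesLaw.closes`. -/
theorem flipFouriersLawFor_of_canonical (P : OscillatorChain) (ε : ℝ)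
    (hEU : ∀ (N : ℕ) (T_L T_R : ℝ), 0 < T_L → 0 < T_R →
      ∃ μ : Measure (PhaseSpace N), P.IsFlipSteadyState N T_L T_R ε μ ∧
        ∀ ν : Measure (PhaseSpace N), P.IsFlipSteadyState N T_L T_R ε ν → ν = μ)
    (hlim : ∀ μ : (N : ℕ) → ℝ → ℝ → Measure (PhaseSpace N),
      (∀ (N : ℕ) (T_L T_R : ℝ), 0 < T_L → 0 < T_R → P.IsFlipSteadyState N T_L T_R ε (μ N T_L T_R)) →
      ∀ T : ℝ, 0 < T → ∃ κT : ℝ, 0 < κT ∧ ∃ D : ℕ → ℝ,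
        (∀ N : ℕ, Tendsto (fun δ : ℝ => P.totalCurrent (μ N (T + δ / 2) (T - δ / 2)) / δ)
          (𝓝[≠] 0) (𝓝 (D N))) ∧ Tendsto D atTop (𝓝 κT)) :
    P.FlipFouriersLawFor ε := by
  have huniq := uniq_of_existsUnique hEU
  refine ⟨hEU, ?_⟩
  classical
  -- the canonical family (junk at non-positive temperatures)
  let μ₀ : (N : ℕ) → ℝ → ℝ → Measure (PhaseSpace N) := fun N T_L T_R =>
    if h : 0 < T_L ∧ 0 < T_R then Classical.choose (hEU N T_L T_R h.1 h.2) else 0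
  have hμ₀ : ∀ (N : ℕ) (T_L T_R : ℝ), 0 < T_L → 0 < T_R →
      P.IsFlipSteadyState N T_L T_R ε (μ₀ N T_L T_R) := by
    intro N T_L T_R hL hR
    simp only [μ₀, dif_pos (And.intro hL hR)]
    exact (Classical.choose_spec (hEU N T_L T_R hL hR)).1
  have key := hlim μ₀ hμ₀
  choose κf hκpos Df hDf hDlim using key
  refine ⟨fun T => if hT : 0 < T then κf T hT else 1, fun T hT => ?_, ?_⟩
  · simp only [dif_pos hT]
    exact hκpos T hT
  intro μ hμ T hT
  refine ⟨Df T hT, fun N => ?_, ?_⟩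
  · refine (hDf T hT N).congr' ?_
    have h2 : ∀ᶠ δ in 𝓝 (0 : ℝ), δ < 2 * T := eventually_lt_nhds (by linarith)
    have h2' : ∀ᶠ δ in 𝓝 (0 : ℝ), -(2 * T) < δ := eventually_gt_nhds (by linarith)
    filter_upwards [mem_nhdsWithin_of_mem_nhds h2, mem_nhdsWithin_of_mem_nhds h2'] with δ hlt hgt
    have ha : 0 < T + δ / 2 := by linarith
    have hb : 0 < T - δ / 2 := by linarith
    rw [huniq N _ _ ha hb (μ₀ N _ _) (μ N _ _) (hμ₀ N _ _ ha hb) (hμ N _ _ ha hb)]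
  · simp only [dif_pos hT]
    exact hDlim T hT

/-! ## The composition (sorry-free): the stub statements ⇒ the crux in its Literature form -/

/-- **`flipFouriersLawFor_of_gluing`** — THE COMPOSITION with explicit hypotheses (sorry-free, axioms
propext / Classical.choice / Quot.sound): the statements of Stubs 1–5 imply
`∀ parameters > 0, ∀ ε > 0, (pinnedChain …).FlipFouriersLawFor ε`, which is the crux
`VanishingNoiseTransfer.NoisyFourier` up to `rfl` (`noisyFourier_iff_flipFouriersLawFor`).
Per `ε, T > 0`, along the canonical flip-steady family: Stub 2 gives `D_N`, Stub 3 `D_N > 0`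
(`N ≥ 2`), Stub 4′ a ceiling `D_N ≤ K`, Stub 5 quasi-subadditive resistances; the refuter's landed
`Drefute.tendsto_pos_of_resistanceGluing_of_bdd` (Fekete on `{N ≥ 2}` for `R_N = (N−1)/D_N`, lower bound
`R_N/N ≥ ((N−1)/N)/K`) gives `D_N → s > 0`; `flipFouriersLawFor_of_canonical` assembles clause (ii)
for every family by uniqueness (Stub 1). -/
theorem flipFouriersLawFor_of_gluing
    (hEU : (∀ ω₂ lam β γ : ℝ, 0 < ω₂ → 0 < lam → 0 < β → 0 < γ → ∀ ε : ℝ, 0 < ε →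
      ∀ (N : ℕ) (T_L T_R : ℝ), 0 < T_L → 0 < T_R →
        ∃ μ : MeasureTheory.Measure
            (Literature.MathematicalPhysics.KineticTheory.HeatConduction.PhaseSpace N),
          (Literature.MathematicalPhysics.KineticTheory.HeatConduction.pinnedChain
              ω₂ lam β γ).IsFlipSteadyState N T_L T_R ε μ ∧
          ∀ ν : MeasureTheory.Measure
              (Literature.MathematicalPhysics.KineticTheory.HeatConduction.PhaseSpace N),
            (Literature.MathematicalPhysics.KineticTheory.HeatConduction.pinnedChain
                ω₂ lam β γ).IsFlipSteadyState N T_L T_R ε ν → ν = μ))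
    (hFR : (∀ ω₂ lam β γ : ℝ, 0 < ω₂ → 0 < lam → 0 < β → 0 < γ → ∀ ε : ℝ, 0 < ε →
      (∀ (N : ℕ) (T_L T_R : ℝ), 0 < T_L → 0 < T_R →
        ∀ μ ν : MeasureTheory.Measure
            (Literature.MathematicalPhysics.KineticTheory.HeatConduction.PhaseSpace N),
          (Literature.MathematicalPhysics.KineticTheory.HeatConduction.pinnedChain
              ω₂ lam β γ).IsFlipSteadyState N T_L T_R ε μ →
          (Literature.MathematicalPhysics.KineticTheory.HeatConduction.pinnedChain
              ω₂ lam β γ).IsFlipSteadyState N T_L T_R ε ν → μ = ν) →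
      ∀ μ : (N : ℕ) → ℝ → ℝ → MeasureTheory.Measure
          (Literature.MathematicalPhysics.KineticTheory.HeatConduction.PhaseSpace N),
        (∀ (N : ℕ) (T_L T_R : ℝ), 0 < T_L → 0 < T_R →
          (Literature.MathematicalPhysics.KineticTheory.HeatConduction.pinnedChain
              ω₂ lam β γ).IsFlipSteadyState N T_L T_R ε (μ N T_L T_R)) →
        ∀ T : ℝ, 0 < T → ∀ N : ℕ, ∃ D : ℝ,
          Filter.Tendsto (fun δ : ℝ =>
            (Literature.MathematicalPhysics.KineticTheory.HeatConduction.pinnedChain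
                ω₂ lam β γ).totalCurrent (μ N (T + δ / 2) (T - δ / 2)) / δ)
            (nhdsWithin 0 {(0 : ℝ)}ᶜ) (nhds D)))
    (hP : (∀ ω₂ lam β γ : ℝ, 0 < ω₂ → 0 < lam → 0 < β → 0 < γ → ∀ ε : ℝ, 0 < ε →
      (∀ (N : ℕ) (T_L T_R : ℝ), 0 < T_L → 0 < T_R →
        ∀ μ ν : MeasureTheory.Measure
            (Literature.MathematicalPhysics.KineticTheory.HeatConduction.PhaseSpace N),
          (Literature.MathematicalPhysics.KineticTheory.HeatConduction.pinnedChain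
              ω₂ lam β γ).IsFlipSteadyState N T_L T_R ε μ →
          (Literature.MathematicalPhysics.KineticTheory.HeatConduction.pinnedChain
              ω₂ lam β γ).IsFlipSteadyState N T_L T_R ε ν → μ = ν) →
      ∀ μ : (N : ℕ) → ℝ → ℝ → MeasureTheory.Measure
          (Literature.MathematicalPhysics.KineticTheory.HeatConduction.PhaseSpace N),
        (∀ (N : ℕ) (T_L T_R : ℝ), 0 < T_L → 0 < T_R →
          (Literature.MathematicalPhysics.KineticTheory.HeatConduction.pinnedChain
              ω₂ lam β γ).IsFlipSteadyState N T_L T_R ε (μ N T_L T_R)) →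
        ∀ T : ℝ, 0 < T → ∀ D : ℕ → ℝ,
          (∀ N : ℕ, Filter.Tendsto (fun δ : ℝ =>
            (Literature.MathematicalPhysics.KineticTheory.HeatConduction.pinnedChain
                ω₂ lam β γ).totalCurrent (μ N (T + δ / 2) (T - δ / 2)) / δ)
            (nhdsWithin 0 {(0 : ℝ)}ᶜ) (nhds (D N))) →
          ∀ N : ℕ, 2 ≤ N → 0 < D N))
    (hK : (∀ ω₂ lam β γ : ℝ, 0 < ω₂ → 0 < lam → 0 < β → 0 < γ → ∀ ε : ℝ, 0 < ε →
      (∀ (N : ℕ) (T_L T_R : ℝ), 0 < T_L → 0 < T_R →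
        ∀ μ ν : MeasureTheory.Measure
            (Literature.MathematicalPhysics.KineticTheory.HeatConduction.PhaseSpace N),
          (Literature.MathematicalPhysics.KineticTheory.HeatConduction.pinnedChain
              ω₂ lam β γ).IsFlipSteadyState N T_L T_R ε μ →
          (Literature.MathematicalPhysics.KineticTheory.HeatConduction.pinnedChain
              ω₂ lam β γ).IsFlipSteadyState N T_L T_R ε ν → μ = ν) →
      ∀ μ : (N : ℕ) → ℝ → ℝ → MeasureTheory.Measure
          (Literature.MathematicalPhysics.KineticTheory.HeatConduction.PhaseSpace N),
        (∀ (N : ℕ) (T_L T_R : ℝ), 0 < T_L → 0 < T_R →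
          (Literature.MathematicalPhysics.KineticTheory.HeatConduction.pinnedChain
              ω₂ lam β γ).IsFlipSteadyState N T_L T_R ε (μ N T_L T_R)) →
        ∀ T : ℝ, 0 < T → ∀ D : ℕ → ℝ,
          (∀ N : ℕ, Filter.Tendsto (fun δ : ℝ =>
            (Literature.MathematicalPhysics.KineticTheory.HeatConduction.pinnedChain
                ω₂ lam β γ).totalCurrent (μ N (T + δ / 2) (T - δ / 2)) / δ)
            (nhdsWithin 0 {(0 : ℝ)}ᶜ) (nhds (D N))) →
          ∃ K : ℝ, ∀ N : ℕ, 2 ≤ N → D N ≤ K))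
    (hR : (∀ ω₂ lam β γ : ℝ, 0 < ω₂ → 0 < lam → 0 < β → 0 < γ → ∀ ε : ℝ, 0 < ε →
      (∀ (N : ℕ) (T_L T_R : ℝ), 0 < T_L → 0 < T_R →
        ∀ μ ν : MeasureTheory.Measure
            (Literature.MathematicalPhysics.KineticTheory.HeatConduction.PhaseSpace N),
          (Literature.MathematicalPhysics.KineticTheory.HeatConduction.pinnedChain
              ω₂ lam β γ).IsFlipSteadyState N T_L T_R ε μ →
          (Literature.MathematicalPhysics.KineticTheory.HeatConduction.pinnedChain
              ω₂ lam β γ).IsFlipSteadyState N T_L T_R ε ν → μ = ν) →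
      ∀ μ : (N : ℕ) → ℝ → ℝ → MeasureTheory.Measure
          (Literature.MathematicalPhysics.KineticTheory.HeatConduction.PhaseSpace N),
        (∀ (N : ℕ) (T_L T_R : ℝ), 0 < T_L → 0 < T_R →
          (Literature.MathematicalPhysics.KineticTheory.HeatConduction.pinnedChain
              ω₂ lam β γ).IsFlipSteadyState N T_L T_R ε (μ N T_L T_R)) →
        ∀ T : ℝ, 0 < T → ∀ D : ℕ → ℝ,
          (∀ N : ℕ, Filter.Tendsto (fun δ : ℝ =>
            (Literature.MathematicalPhysics.KineticTheory.HeatConduction.pinnedChain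
                ω₂ lam β γ).totalCurrent (μ N (T + δ / 2) (T - δ / 2)) / δ)
            (nhdsWithin 0 {(0 : ℝ)}ᶜ) (nhds (D N))) →
          (∀ N : ℕ, 2 ≤ N → 0 < D N) →
          ∃ C : ℝ, ∀ N M : ℕ, 2 ≤ N → 2 ≤ M →
            (((N + M : ℕ) : ℝ) - 1) / D (N + M) ≤
              ((N : ℝ) - 1) / D N + ((M : ℝ) - 1) / D M + C)) :
    ∀ ω₂ lam β γ : ℝ, 0 < ω₂ → 0 < lam → 0 < β → 0 < γ → ∀ ε : ℝ, 0 < ε →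
      (Literature.MathematicalPhysics.KineticTheory.HeatConduction.pinnedChain
          ω₂ lam β γ).FlipFouriersLawFor ε := by
  intro ω₂ lam β γ hω hl hβ hγ ε hε
  refine flipFouriersLawFor_of_canonical (pinnedChain ω₂ lam β γ) ε
    (hEU ω₂ lam β γ hω hl hβ hγ ε hε) fun μ hμ T hT => ?_
  have huniq := uniq_of_existsUnique (hEU ω₂ lam β γ hω hl hβ hγ ε hε)
  have hDex := hFR ω₂ lam β γ hω hl hβ hγ ε hε huniq μ hμ T hT
  choose D hD using hDex
  have hpos : ∀ N : ℕ, 2 ≤ N → 0 < D N := hP ω₂ lam β γ hω hl hβ hγ ε hε huniq μ hμ T hT D hD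
  obtain ⟨K, hK'⟩ := hK ω₂ lam β γ hω hl hβ hγ ε hε huniq μ hμ T hT D hD
  obtain ⟨C', hC'⟩ := hR ω₂ lam β γ hω hl hβ hγ ε hε huniq μ hμ T hT D hD hpos
  obtain ⟨s, hs0, hDs⟩ := Drefute.tendsto_pos_of_resistanceGluing_of_bdd hpos hK' hC'
  exact ⟨s, hs0, D, hD, hDs⟩

/-- **The crux is `FlipFouriersLawFor` at every `ε > 0`** (= Disproof §0 `noisyFourier_iff`,
re-proved here so that the skeleton is self-contained): the route's inlined steady-state
predicate is `OscillatorChain.IsFlipSteadyState` by `rfl` (`isFlipSteadyState_fun_eq`). -/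
theorem noisyFourier_iff_flipFouriersLawFor :
    Summit.AtomisticToContinuum.FouriersLaw.Theses.VanishingNoiseTransfer.NoisyFourier ↔
      (∀ ω₂ lam β γ : ℝ, 0 < ω₂ → 0 < lam → 0 < β → 0 < γ → ∀ ε : ℝ, 0 < ε →
      (Literature.MathematicalPhysics.KineticTheory.HeatConduction.pinnedChain
          ω₂ lam β γ).FlipFouriersLawFor ε) := by
  constructor
  · intro h ω₂ lam β γ hω hl hβ hγ ε hε
    exact h ω₂ lam β γ hω hl hβ hγ _ rfl ε hε
  · intro h ω₂ lam β γ hω hl hβ hγ S hS ε hε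
    subst hS
    exact h ω₂ lam β γ hω hl hβ hγ ε hε

/-! ## The Kubo-limit reduction (copy of `Theorems/VanishingNoiseTransferNoisyFourierOfKuboLimit.lean`, p127584,
so that this workfile elaborates against built modules only; the landed names live in namespace `…Theorems.NoisyFourier.LineAssembly`) -/

/-- **Response limit from the Green–Kubo limit.** Given the dual forward fields `FF''(ε)` (hypothesis `hFF`, the
derivative-free package of `FlipPositiveConductance.dualForwardFields_of_mild_hypo_upgrade_cont`, discharged below)
and the Kubo-limit hypothesis `hκ` (for all parameters, `T, ε > 0`: `∃ κ > 0` with `(L−1)·γ(1 − (γ/T²)⟨g L, p_0² − T⟩) → κ`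
for every family `g` of classical `C² ∩ L²(μ_T)` forward fields), the response coefficients along every flip-steady
family converge to a positive limit: per `L ≥ 2` the Kubo link identifies `D_L` with `(L−1)·G_L` computed from the
equilibrium member `g 0` of the dual field package, and `hκ` is applied to that family (junk `0` below `L = 2`). -/
theorem responseLimit_of_dualForwardFields_of_kuboLimit
    (hFF : ∀ (ω₂ lam β γ T ε : ℝ), 0 < ω₂ → 0 < lam → 0 < β → 0 < γ → 0 < T → 0 < ε → ∀ μ : (N : ℕ) → ℝ → ℝ → MeasureTheory.Measure (Literature.MathematicalPhysics.KineticTheory.HeatConduction.PhaseSpace N), (∀ (N : ℕ) (T_L T_R : ℝ), 0 < T_L → 0 < T_R → (Literature.MathematicalPhysics.KineticTheory.HeatConduction.pinnedChain ω₂ lam β γ).IsFlipSteadyState N T_L T_R ε (μ N T_L T_R) ∧ ∀ ν : MeasureTheory.Measure (Literature.MathematicalPhysics.KineticTheory.HeatConduction.PhaseSpace N), (Literature.MathematicalPhysics.KineticTheory.HeatConduction.pinnedChain ω₂ lam β γ).IsFlipSteadyState N T_L T_R ε ν → ν = μ N T_L T_R) → ∀ (L : ℕ) (hL : 2 ≤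 L), ∃ (g : ℝ → Literature.MathematicalPhysics.KineticTheory.HeatConduction.PhaseSpace L → ℝ) (δ₀ : ℝ), 0 < δ₀ ∧ ContDiff ℝ 2 (g 0) ∧ (∀ x, (Literature.MathematicalPhysics.KineticTheory.HeatConduction.pinnedChain ω₂ lam β γ).flipGenerator L T T ε (g 0) x = -(Summit.AtomisticToContinuum.FouriersLaw.Theorems.SuperadditiveResistance.DeviceLiouville.kin L 0 x - T)) ∧ (∀ δ, |δ| < δ₀ → ∃ C : ℝ, ∀ x, |g δ x| ≤ C * Real.exp (1 / (4 * T) * (Literature.MathematicalPhysics.KineticTheory.HeatConduction.pinnedChain ω₂ lam β γ).hamiltonian L x)) ∧ (∀ δ, 0 < |δ| → |δ| < δ₀ → Measurable (g δ) ∧ ∀ φ : Literature.MathematicalPhysics.KineticTheory.HeatConduction.PhaseSpace L → ℝ, ContDiff ℝ ((⊤ : ℕ∞) : WithTop ℕ∞) φ → HasCompactSupport φ → ∫ x, g δ x * (-((Literature.MathematicalPhysics.KineticTheory.HeatConduction.pinnedChain ω₂ lam β γ).generator L (T + δ / 2) (T - δ / 2) φ x) + 2 * γ * ((T + δ / 2)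 * Literature.MathematicalPhysics.KineticTheory.HeatConduction.partialP (⟨0, by omega⟩ : Fin L) (Literature.MathematicalPhysics.KineticTheory.HeatConduction.partialP (⟨0, by omega⟩ : Fin L) φ) x + (T - δ / 2) * Literature.MathematicalPhysics.KineticTheory.HeatConduction.partialP (⟨L - 1, by omega⟩ : Fin L) (Literature.MathematicalPhysics.KineticTheory.HeatConduction.partialP (⟨L - 1, by omega⟩ : Fin L) φ) x) + 2 * γ * φ x + ε * Literature.MathematicalPhysics.KineticTheory.HeatConduction.flipNoise L φ x) = ∫ x, (-(Summit.AtomisticToContinuum.FouriersLaw.Theorems.SuperadditiveResistance.DeviceLiouville.kin L 0 x - T) + ∫ y, (Summit.AtomisticToContinuum.FouriersLaw.Theorems.SuperadditiveResistance.DeviceLiouville.kin L 0 y - T) ∂(μ L (T + δ / 2) (T - δ / 2))) * φ x) ∧ Filter.Tendsto (fun δ => ∫ x, g δ x * (Summit.AtomisticToContinuum.FouriersLaw.Theorems.SuperadditiveResistance.DeviceLiouville.kin L 0 x - T) ∂((Literature.MathematicalPhysics.KineticTheory.HeatConduction.pinnedChain ω₂ lam β γ).gibbsMeasure L T)) (nhdsWithin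 0 {(0 : ℝ)}ᶜ) (nhds (∫ x, g 0 x * (Summit.AtomisticToContinuum.FouriersLaw.Theorems.SuperadditiveResistance.DeviceLiouville.kin L 0 x - T) ∂((Literature.MathematicalPhysics.KineticTheory.HeatConduction.pinnedChain ω₂ lam β γ).gibbsMeasure L T))) ∧ Filter.Tendsto (fun δ => ∫ x, g δ x * (Summit.AtomisticToContinuum.FouriersLaw.Theorems.SuperadditiveResistance.DeviceLiouville.kin L (L - 1) x - T) ∂((Literature.MathematicalPhysics.KineticTheory.HeatConduction.pinnedChain ω₂ lam β γ).gibbsMeasure L T)) (nhdsWithin 0 {(0 : ℝ)}ᶜ) (nhds (∫ x, g 0 x * (Summit.AtomisticToContinuum.FouriersLaw.Theorems.SuperadditiveResistance.DeviceLiouville.kin L (L - 1) x - T) ∂((Literature.MathematicalPhysics.KineticTheory.HeatConduction.pinnedChain ω₂ lam β γ).gibbsMeasure L T))))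
    (hκ : ∀ (ω₂ lam β γ T ε : ℝ), 0 < ω₂ → 0 < lam → 0 < β → 0 < γ → 0 < T → 0 < ε → ∃ κ : ℝ, 0 < κ ∧ ∀ g : (L : ℕ) → Literature.MathematicalPhysics.KineticTheory.HeatConduction.PhaseSpace L → ℝ, (∀ L : ℕ, 2 ≤ L → ContDiff ℝ 2 (g L) ∧ MeasureTheory.MemLp (g L) 2 ((Literature.MathematicalPhysics.KineticTheory.HeatConduction.pinnedChain ω₂ lam β γ).gibbsMeasure L T) ∧ ∀ x, (Literature.MathematicalPhysics.KineticTheory.HeatConduction.pinnedChain ω₂ lam β γ).flipGenerator L T T ε (g L) x = -(Summit.AtomisticToContinuum.FouriersLaw.Theorems.SuperadditiveResistance.DeviceLiouville.kin L 0 x - T)) → Filter.Tendsto (fun L : ℕ => ((L : ℝ) - 1) * (γ * (1 - γ / T ^ 2 * MeasureTheory.integral ((Literature.MathematicalPhysics.KineticTheory.HeatConduction.pinnedChain ω₂ lam β γ).gibbsMeasure L T) (fun x => g L x * (Summit.AtomisticToContinuum.FouriersLaw.Theorems.SuperadditiveResistance.DeviceLiouville.kin L 0 x - T))))) Filter.atTop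 (nhds κ)) :
    (∀ ω₂ lam β γ : ℝ, 0 < ω₂ → 0 < lam → 0 < β → 0 < γ → ∀ ε : ℝ, 0 < ε →
      (∀ (N : ℕ) (T_L T_R : ℝ), 0 < T_L → 0 < T_R →
        ∀ μ ν : MeasureTheory.Measure
            (Literature.MathematicalPhysics.KineticTheory.HeatConduction.PhaseSpace N),
          (Literature.MathematicalPhysics.KineticTheory.HeatConduction.pinnedChain
              ω₂ lam β γ).IsFlipSteadyState N T_L T_R ε μ →
          (Literature.MathematicalPhysics.KineticTheory.HeatConduction.pinnedChain
              ω₂ lam β γ).IsFlipSteadyState N T_L T_R ε ν → μ = ν) →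
      ∀ μ : (N : ℕ) → ℝ → ℝ → MeasureTheory.Measure
          (Literature.MathematicalPhysics.KineticTheory.HeatConduction.PhaseSpace N),
        (∀ (N : ℕ) (T_L T_R : ℝ), 0 < T_L → 0 < T_R →
          (Literature.MathematicalPhysics.KineticTheory.HeatConduction.pinnedChain
              ω₂ lam β γ).IsFlipSteadyState N T_L T_R ε (μ N T_L T_R)) →
        ∀ T : ℝ, 0 < T → ∀ D : ℕ → ℝ,
          (∀ N : ℕ, Filter.Tendsto (fun δ : ℝ =>
            (Literature.MathematicalPhysics.KineticTheory.HeatConduction.pinnedChain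
                ω₂ lam β γ).totalCurrent (μ N (T + δ / 2) (T - δ / 2)) / δ)
            (nhdsWithin 0 {(0 : ℝ)}ᶜ) (nhds (D N))) →
          ∃ s : ℝ, 0 < s ∧ Filter.Tendsto D Filter.atTop (nhds s)) := by
  intro ω₂ lam β γ hω hl hβ hγ ε hε huniq μ hμ T hT D hD
  obtain ⟨κ, hκ0, hκlim⟩ := hκ ω₂ lam β γ T ε hω hl hβ hγ hT hε
  have hμ' : ∀ (N : ℕ) (T_L T_R : ℝ), 0 < T_L → 0 < T_R →
      (pinnedChain ω₂ lam β γ).IsFlipSteadyState N T_L T_R ε (μ N T_L T_R) ∧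
        ∀ ν : Measure (PhaseSpace N),
          (pinnedChain ω₂ lam β γ).IsFlipSteadyState N T_L T_R ε ν → ν = μ N T_L T_R :=
    fun N T_L T_R hL hR =>
      ⟨hμ N T_L T_R hL hR, fun ν hν => huniq N T_L T_R hL hR ν (μ N T_L T_R) hν (hμ N T_L T_R hL hR)⟩
  have h14' : 2 * (1 / (4 * T)) < 1 / T := by
    rw [show 2 * (1 / (4 * T)) = 1 / (2 * T) by field_simp; ring, div_lt_div_iff₀ (by positivity) hT]
    nlinarith
  -- per `N ≥ 2`: a classical forward field with the Kubo link
  have key : ∀ N : ℕ, 2 ≤ N → ∃ g0 : PhaseSpace N → ℝ, ContDiff ℝ 2 g0 ∧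
      MemLp g0 2 ((pinnedChain ω₂ lam β γ).gibbsMeasure N T) ∧
      (∀ x, (pinnedChain ω₂ lam β γ).flipGenerator N T T ε g0 x = -(kin N 0 x - T)) ∧
      D N = ((N : ℝ) - 1) * (γ * (1 - γ / T ^ 2 *
        ∫ x, g0 x * (kin N 0 x - T) ∂((pinnedChain ω₂ lam β γ).gibbsMeasure N T))) := by
    intro N hN
    obtain ⟨g, δ₀, hδ₀, hC, hpde, hbd, hweak, hlim0, hlim1⟩ :=
      hFF ω₂ lam β γ T ε hω hl hβ hγ hT hε μ hμ' N hN
    obtain ⟨C₀, hgb0⟩ := hbd 0 (by simpa using hδ₀)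
    have hlink := VanishingNoiseBound.flip_kuboLink_of_dualForwardFields μ D hω hl hβ hγ hT hε hμ' hN (hD N)
      g hδ₀ (fun δ h0 h1 => ((hweak δ h0 h1).1).aestronglyMeasurable) (fun δ _ h1 => hbd δ h1)
      (fun δ h0 h1 => (hweak δ h0 h1).2) hlim0 hlim1 hC hgb0 hpde
    have hgL2 : MemLp (g 0) 2 ((pinnedChain ω₂ lam β γ).gibbsMeasure N T) :=
      memLp_two_of_abs_le_exp hω hl.le hβ.le γ N hT h14' hC.continuous hgb0
    have hN1 : 0 < (N : ℝ) - 1 := by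
      have : (2 : ℝ) ≤ (N : ℝ) := by exact_mod_cast hN
      linarith
    refine ⟨g 0, hC, hgL2, hpde, ?_⟩
    rw [← hlink]
    field_simp
  classical
  let gfam : (L : ℕ) → PhaseSpace L → ℝ := fun L =>
    if h : 2 ≤ L then Classical.choose (key L h) else fun _ => 0
  have hgfam : ∀ L : ℕ, 2 ≤ L → ContDiff ℝ 2 (gfam L) ∧
      MemLp (gfam L) 2 ((pinnedChain ω₂ lam β γ).gibbsMeasure L T) ∧
      ∀ x, (pinnedChain ω₂ lam β γ).flipGenerator L T T ε (gfam L) x = -(kin L 0 x - T) := by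
    intro L hL
    have hspec := Classical.choose_spec (key L hL)
    simp only [gfam, dif_pos hL]
    exact ⟨hspec.1, hspec.2.1, hspec.2.2.1⟩
  have hDL : ∀ L : ℕ, 2 ≤ L → D L = ((L : ℝ) - 1) * (γ * (1 - γ / T ^ 2 *
      ∫ x, gfam L x * (kin L 0 x - T) ∂((pinnedChain ω₂ lam β γ).gibbsMeasure L T))) := by
    intro L hL
    have hspec := Classical.choose_spec (key L hL)
    simp only [gfam, dif_pos hL]
    exact hspec.2.2.2
  have hlim := hκlim gfam hgfam
  refine ⟨κ, hκ0, ?_⟩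
  refine hlim.congr' ?_
  filter_upwards [eventually_ge_atTop 2] with L hL
  exact (hDL L hL).symm

/-- `FlipFouriersLawFor` at every `ε > 0` from the Kubo-limit statement (the shape of `stub_flipKuboLimit`): clause (i)
and the fixed-`L` response are the landed stubs, the dual forward fields come from the four landed `VanishingNoiseBound`
stubs, and `flipFouriersLawFor_of_canonical` transfers clause (ii) to every family. Sorry-free. -/
theorem flipFouriersLawFor_of_kuboLimit
    (hκ : ∀ (ω₂ lam β γ T ε : ℝ), 0 < ω₂ → 0 < lam → 0 < β → 0 < γ → 0 < T → 0 < ε → ∃ κ : ℝ, 0 < κ ∧ ∀ g : (L : ℕ) → Literature.MathematicalPhysics.KineticTheory.HeatConduction.PhaseSpace L → ℝ, (∀ L : ℕ, 2 ≤ L → ContDiff ℝ 2 (g L) ∧ MeasureTheory.MemLp (g L) 2 ((Literature.MathematicalPhysics.KineticTheory.HeatConduction.pinnedChain ω₂ lam β γ).gibbsMeasure L T) ∧ ∀ x, (Literature.MathematicalPhysics.KineticTheory.HeatConduction.pinnedChain ω₂ lam β γ).flipGenerator L T T ε (g L) x = -(Summit.AtomisticToContinuum.FouriersLaw.Theorems.SuperadditiveResistance.DeviceLiouville.kin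 L 0 x - T)) → Filter.Tendsto (fun L : ℕ => ((L : ℝ) - 1) * (γ * (1 - γ / T ^ 2 * MeasureTheory.integral ((Literature.MathematicalPhysics.KineticTheory.HeatConduction.pinnedChain ω₂ lam β γ).gibbsMeasure L T) (fun x => g L x * (Summit.AtomisticToContinuum.FouriersLaw.Theorems.SuperadditiveResistance.DeviceLiouville.kin L 0 x - T))))) Filter.atTop (nhds κ)) :
    ∀ ω₂ lam β γ : ℝ, 0 < ω₂ → 0 < lam → 0 < β → 0 < γ → ∀ ε : ℝ, 0 < ε →
      (Literature.MathematicalPhysics.KineticTheory.HeatConduction.pinnedChain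
          ω₂ lam β γ).FlipFouriersLawFor ε := by
  intro ω₂ lam β γ hω hl hβ hγ ε hε
  have hEU := existsUnique_of_exists_of_unique stub_flipNessExists flipNessUnique ω₂ lam β γ hω hl hβ hγ ε hε
  refine flipFouriersLawFor_of_canonical (pinnedChain ω₂ lam β γ) ε hEU fun μ hμ T hT => ?_
  have huniq := uniq_of_existsUnique hEU
  have hDex := stub_flipFiniteResponse ω₂ lam β γ hω hl hβ hγ ε hε huniq μ hμ T hT
  choose D hD using hDex
  obtain ⟨s, hs0, hDs⟩ :=
    responseLimit_of_dualForwardFields_of_kuboLimit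
      (NoisyFourier.FlipPositiveConductance.dualForwardFields_of_mild_hypo_upgrade_cont
        VanishingNoiseBound.stub_flipMildDistributional
        VanishingNoiseBound.stub_flipHypoelliptic
        VanishingNoiseBound.stub_flipSmoothMildUpgrade
        VanishingNoiseBound.stub_flipMildContinuity)
      hκ ω₂ lam β γ hω hl hβ hγ ε hε huniq μ hμ T hT D hD
  exact ⟨s, hs0, D, hD, hDs⟩

/-! ## The skeleton theorem `NoisyFourier_of` (concludes the crux BY NAME; sorries only via the stubs) -/

/-- **`NoisyFourier_of`** — the registered skeleton: the crux
`Summit.AtomisticToContinuum.FouriersLaw.Theses.VanishingNoiseTransfer.NoisyFourier` follows from the single open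
stub `stub_flipKuboLimit` through the sorry-free reduction `flipFouriersLawFor_of_kuboLimit` (= the LANDED
`LineAssembly.noisyFourier_of_kuboLimit`, p127584: clause (i), the fixed-`L` response, the dual forward fields, the
Kubo link and the canonical-family assembly are all inside it).
It takes NO hypotheses (A12 shape); its axiom closure is `{propext, Classical.choice, Quot.sound} ∪ {sorryAx via the
stub}` until the stub is proved. -/
theorem NoisyFourier_of :
    Summit.AtomisticToContinuum.FouriersLaw.Theses.VanishingNoiseTransfer.NoisyFourier :=
  noisyFourier_iff_flipFouriersLawFor.2 (flipFouriersLawFor_of_kuboLimit stub_flipKuboLimit)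

/-- The series-law route, kept as a named alternative: the former Stub 5 statement also closes the crux
(landed reduction p124321). -/
theorem NoisyFourier_of_seriesLaw
    (hR : ∀ ω₂ lam β γ : ℝ, 0 < ω₂ → 0 < lam → 0 < β → 0 < γ → ∀ ε : ℝ, 0 < ε →
      (∀ (N : ℕ) (T_L T_R : ℝ), 0 < T_L → 0 < T_R →
        ∀ μ ν : MeasureTheory.Measure
            (Literature.MathematicalPhysics.KineticTheory.HeatConduction.PhaseSpace N),
          (Literature.MathematicalPhysics.KineticTheory.HeatConduction.pinnedChain
              ω₂ lam β γ).IsFlipSteadyState N T_L T_R ε μ →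
          (Literature.MathematicalPhysics.KineticTheory.HeatConduction.pinnedChain
              ω₂ lam β γ).IsFlipSteadyState N T_L T_R ε ν → μ = ν) →
      ∀ μ : (N : ℕ) → ℝ → ℝ → MeasureTheory.Measure
          (Literature.MathematicalPhysics.KineticTheory.HeatConduction.PhaseSpace N),
        (∀ (N : ℕ) (T_L T_R : ℝ), 0 < T_L → 0 < T_R →
          (Literature.MathematicalPhysics.KineticTheory.HeatConduction.pinnedChain
              ω₂ lam β γ).IsFlipSteadyState N T_L T_R ε (μ N T_L T_R)) →
        ∀ T : ℝ, 0 < T → ∀ D : ℕ → ℝ,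
          (∀ N : ℕ, Filter.Tendsto (fun δ : ℝ =>
            (Literature.MathematicalPhysics.KineticTheory.HeatConduction.pinnedChain
                ω₂ lam β γ).totalCurrent (μ N (T + δ / 2) (T - δ / 2)) / δ)
            (nhdsWithin 0 {(0 : ℝ)}ᶜ) (nhds (D N))) →
          (∀ N : ℕ, 2 ≤ N → 0 < D N) →
          ∃ C : ℝ, ∀ N M : ℕ, 2 ≤ N → 2 ≤ M →
            (((N + M : ℕ) : ℝ) - 1) / D (N + M) ≤
              ((N : ℝ) - 1) / D N + ((M : ℝ) - 1) / D M + C) :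
    Summit.AtomisticToContinuum.FouriersLaw.Theses.VanishingNoiseTransfer.NoisyFourier :=
  noisyFourier_iff_flipFouriersLawFor.2
    (flipFouriersLawFor_of_gluing
      (existsUnique_of_exists_of_unique stub_flipNessExists flipNessUnique)
      stub_flipFiniteResponse stub_flipPositiveConductance stub_flipConductanceCeiling hR)

end Summit.AtomisticToContinuum.FouriersLaw.Cruxes.NoisyFourier.SectorDirichletGluing

end
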